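import Mathlib
import Summits.Ventures.PercRepro2.CoinTreeCore
import Summits.Ventures.PercRepro2.CoinTreeAncestor
import Summits.Ventures.PercRepro2.CoinOrTailKDefs
import Summits.Ventures.PercRepro2.CoinOrTailKSums
import Summits.Ventures.PercRepro2.CoinOrTailKAlg
import Summits.Ventures.PercRepro2.CoinOrTailKCore
import Summits.Ventures.PercRepro2.CoinMixBlock
import Summits.Ventures.PercRepro2.CoinOrTailKOneAlg
import Summits.Ventures.PercRepro2.CoinOrTailKChainAlg
import Summits.Ventures.PercRepro2.CoinOrTailKChainFunctional
import Summits.Ventures.PercRepro2.CoinOrTailKChainCore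

/-!
# An undominated BRANCH with two arcs into the tail, and a tail fed ONLY from a branch with the
markers elsewhere — two instantiation checks (blind cell PercRepro2, night-2 g11; NIGHT2-DARC.md §45)

A concrete coin system on `Fin 8` (s = 0, p = 1, q = 2, r₁ = 3, r₂ = 4, a = 5, w = 6, t = 7):
`s → p → a`, `s → q → a`, `s → r₁ → r₂ → a` with `r₁ → a` as well — FOUR entries of the tail, the two
on the branch `r₁ → r₂` through NO marker — and the head coins `a → t`, `w → t`, `r₂ → w`; eleven
coins, all random.  The core `U = {p, q, r₁, r₂}` is an out-tree (`TreeCore`, by `decide`), `OrTailK`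
holds by `decide`, and `darc_of_orTailTreeKChain` with `und = {r₁, r₂}` (a chain: `r₁` is the parent
of `r₂`) gives row 2′DARC at `a → w` for the markers `p, q` and every probability vector.
-/

namespace Summit.Ventures.PercRepro2.Coin

namespace OrTailKChainExample

open Classical

/-- The eleven coins of the example. -/
def arcsEx : Fin 11 → Finset (Fin 8 × Fin 8)
  | 0 => {(0, 1)}   -- s → p
  | 1 => {(0, 2)}   -- s → q
  | 2 => {(0, 3)}   -- s → r₁
  | 3 => {(3, 4)}   -- r₁ → r₂
  | 4 => {(1, 5)}   -- p → a
  | 5 => {(2, 5)}   -- q → a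
  | 6 => {(3, 5)}   -- r₁ → a
  | 7 => {(4, 5)}   -- r₂ → a
  | 8 => {(5, 7)}   -- a → t
  | 9 => {(6, 7)}   -- w → t
  | 10 => {(4, 6)}  -- r₂ → w

/-- The entry coins: `c p = 4`, `c q = 5`, `c r₁ = 6`, `c r₂ = 7`. -/
def cEx : Fin 8 → Fin 11
  | 1 => 4
  | 2 => 5
  | 3 => 6
  | 4 => 7
  | _ => 0

/-- The tree coins. -/
def tcEx : Fin 8 → Fin 11
  | 1 => 0
  | 2 => 1
  | 3 => 2
  | 4 => 3
  | _ => 0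

/-- The parent map. -/
def parEx : Fin 8 → Fin 8
  | 4 => 3
  | _ => 0

/-- The rank. -/
def rkEx : Fin 8 → ℕ
  | 1 => 1
  | 2 => 1
  | 3 => 1
  | 4 => 2
  | _ => 0

/-- Every coin is a single arc, so `SameEnds` holds. -/
lemma sameEnds_ex : SameEnds arcsEx := by
  intro e xy hxy x'y' hx'y'
  fin_cases e <;> simp [arcsEx] at hxy hx'y' <;> subst hxy <;> subst hx'y' <;>
    exact ⟨Or.inl rfl, Or.inr rfl⟩

/-- `{p, q, r₁, r₂}` is an out-tree core of `s`. -/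
lemma treeCore_ex : TreeCore arcsEx 0 {1, 2, 3, 4} tcEx parEx rkEx where
  tree := by decide
  par_mem := by decide
  rank := by decide
  into_C := by decide
  into_s := by decide
  s_notin := by decide

/-- The core with the tail `a = 5` entered from `p, q, r₁, r₂` is a four-entry OR-tail. -/
lemma orTailK_ex : OrTailK arcsEx 0 {1, 2, 3, 4} {1, 2, 3, 4} cEx 5 where
  ent_sub := by decide
  s_notin := by decide
  a_notin := by decide
  a_ne_s := by decide
  into_U := by decide
  into_s := by decide
  into_a := by decide
  arcs_c := by decide
  c_inj := by decide

/-- **Row 2′DARC at the arc `a → w` for the markers `p, q` with the undominated branch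
`r₁ → r₂` feeding the tail twice, for every probability vector.** -/
theorem darc_orTailKChain_example {R : Type*} [Field R] [LinearOrder R] [IsStrictOrderedRing R]
    (pr : Fin 11 → R) (hp : IsProbVec pr) :
    DARC pr arcsEx 0 {7} 1 2 5 6 :=
  darc_of_orTailTreeKChain pr hp sameEnds_ex orTailK_ex treeCore_ex (by decide) (by decide)
    (und := {3, 4}) (by decide)
    (by
      intro r hr hru
      fin_cases hr
      · exact Or.inl ⟨0, by decide, by decide⟩
      · exact Or.inr ⟨0, by decide, by decide⟩
      · exact absurd (by decide) hru
      · exact absurd (by decide) hru)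
    (by
      intro r hr r' hr'
      fin_cases hr <;> fin_cases hr'
      · exact Or.inl ⟨0, by decide, by decide⟩
      · exact Or.inr ⟨1, by decide, by decide⟩
      · exact Or.inl ⟨1, by decide, by decide⟩
      · exact Or.inl ⟨0, by decide, by decide⟩)
    (by decide) (by decide) (by decide) (by decide)

end OrTailKChainExample

namespace OrTailKPathExample

open Classical

/-- The ten coins of the example: `s → m₁`, `s → m₂` (the markers, on no route to the tail),
`s → r₁ → r₂` with `r₁ → a`, `r₂ → a` (the tail fed only from the branch), the head `a → t`,
`w → t`, `m₁ → w`, `m₂ → t`. -/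
def arcsEx : Fin 10 → Finset (Fin 8 × Fin 8)
  | 0 => {(0, 1)}   -- s → m₁
  | 1 => {(0, 2)}   -- s → m₂
  | 2 => {(0, 3)}   -- s → r₁
  | 3 => {(3, 4)}   -- r₁ → r₂
  | 4 => {(3, 5)}   -- r₁ → a
  | 5 => {(4, 5)}   -- r₂ → a
  | 6 => {(5, 7)}   -- a → t
  | 7 => {(6, 7)}   -- w → t
  | 8 => {(1, 6)}   -- m₁ → w
  | 9 => {(2, 7)}   -- m₂ → t

/-- The entry coins: `c r₁ = 4`, `c r₂ = 5`. -/
def cEx : Fin 8 → Fin 10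
  | 3 => 4
  | 4 => 5
  | _ => 0

/-- The tree coins. -/
def tcEx : Fin 8 → Fin 10
  | 1 => 0
  | 2 => 1
  | 3 => 2
  | 4 => 3
  | _ => 0

/-- The parent map. -/
def parEx : Fin 8 → Fin 8
  | 4 => 3
  | _ => 0

/-- The rank. -/
def rkEx : Fin 8 → ℕ
  | 1 => 1
  | 2 => 1
  | 3 => 1
  | 4 => 2
  | _ => 0

/-- Every coin is a single arc, so `SameEnds` holds. -/
lemma sameEnds_ex : SameEnds arcsEx := by
  intro e xy hxy x'y' hx'y'
  fin_cases e <;> simp [arcsEx] at hxy hx'y' <;> subst hxy <;> subst hx'y' <;>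
    exact ⟨Or.inl rfl, Or.inr rfl⟩

/-- `{m₁, m₂, r₁, r₂}` is an out-tree core of `s`. -/
lemma treeCore_ex : TreeCore arcsEx 0 {1, 2, 3, 4} tcEx parEx rkEx where
  tree := by decide
  par_mem := by decide
  rank := by decide
  into_C := by decide
  into_s := by decide
  s_notin := by decide

/-- The core with the tail `a = 5` entered from `r₁, r₂` only is a two-entry OR-tail. -/
lemma orTailK_ex : OrTailK arcsEx 0 {1, 2, 3, 4} {3, 4} cEx 5 where
  ent_sub := by decide
  s_notin := by decide
  a_notin := by decide
  a_ne_s := by decide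
  into_U := by decide
  into_s := by decide
  into_a := by decide
  arcs_c := by decide
  c_inj := by decide

/-- **Row 2′DARC at `a → w` for the markers `m₁, m₂` — which lie on NO route to the tail — when
the tail is fed only from the branch `r₁ → r₂`, for every probability vector.** -/
theorem darc_orTailKPath_example {R : Type*} [Field R] [LinearOrder R] [IsStrictOrderedRing R]
    (pr : Fin 10 → R) (hp : IsProbVec pr) :
    DARC pr arcsEx 0 {7} 1 2 5 6 :=
  darc_of_orTailTreeKPath pr hp sameEnds_ex orTailK_ex treeCore_ex (by decide) (by decide)
    (by
      intro r hr r' hr'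
      fin_cases hr <;> fin_cases hr'
      · exact Or.inl ⟨0, by decide, by decide⟩
      · exact Or.inr ⟨1, by decide, by decide⟩
      · exact Or.inl ⟨1, by decide, by decide⟩
      · exact Or.inl ⟨0, by decide, by decide⟩)
    (by decide) (by decide) (by decide) (by decide)

end OrTailKPathExample

end Summit.Ventures.PercRepro2.Coin
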